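import Summits.BirchSwinnertonDyer.BirchSwinnertonDyer.Theorems.PrintCFramBottomClassIndexLawFiveLeEisensteinEndStateV19Binders
import Summits.BirchSwinnertonDyer.BirchSwinnertonDyer.Theorems.PrintCFramBottomClassIndexLawFiveLeHeegnerFieldSupplySocket
import HarnessLib

/-!
# Crux `PrintCFram.BottomClassIndexLawFiveLe` (stmt-BirchSwinnertonDyer-20372), line `eisenstein-resource-bdp-line`, registry v19:
# END STATE v19 WITH BOTH RESIDUES IN ELEMENTARY CURRENCY — the analytic residue CURVE-FREE (w8 g4's (P): a pure statement about
# generalized Bernoulli numbers of quadratic characters) and the arithmetic residue in the crux's own binders (B1-level, B1-sha)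

Cell `bsd-print-cfram`, seat `bsd-line-cfram-p1` LEAD g11, `--supports stmt-BirchSwinnertonDyer-20372` (helper). THEOREMS ONLY; no
definition, no named fact, no `sorry`. BSD is not proved by any of this; no summit statement is proved by this seat; the crux stays OPEN.

* `bottomClassIndexLawFiveLe_of_prints4_of_mazurWiles_of_krizLi_of_bernoulliSupply_of_level_of_sha` — **crux ⟸ (FOUR print facts) ∧
  (Mazur–Wiles Thm 2) ∧ (Kriz–Li Thm 1.20) ∧ (P) ∧ B1-level ∧ B1-sha**, where
  - **(P)** (w8 g4 `HeegnerFieldSupply.stubC_of_splitPrimes_bernoulliUnit`, p676235 — Stub C VERBATIM ⟸ (P)): for every prime `p ≥ 5`, every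
    primitive quadratic `χ` mod `m ⊥ p` and `k ∈ {(p+1)/4, (3p−1)/4}` with `2 ≤ k ≤ p−2`, `χ(−1)(−1)^k = −1` and `p ∤ B_{p−k,χ}/(p−k)`, there is an
    imaginary quadratic field `K''` in which every prime `q ∣ pm` SPLITS, with `d_{K''}` odd `< −4`, a Kronecker character `ε_{K''}`, and
    `p ∤ B_{k,(χ↑ε_{K''}↑)~}/k` — NO elliptic curve, NO `p`-adic `L`-function, NO Heegner point: generalized Bernoulli numbers of quadratic
    characters with a splitting condition;
  - **B1-level** / **B1-sha** (`…EisensteinEndStateV19Binders`): `BSD_p` for the rank-one class members whose generator is `p`-divisible in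
    `W(ℚ_p)`, resp. with `Ш(W/ℚ)[p] ≠ 0` — NO character, NO Bernoulli number.

So on this line the crux C2 is: FIVE refereed print facts + Kriz–Li Thm 1.20 + ONE statement of analytic number theory about Bernoulli numbers
+ `BSD_p` on two explicit subfamilies of the class (invisible generator / non-trivial `Ш[p]`). References: crux workfiles
`Lines/eisenstein_resource_bdp_line.lean` (v19), `Lines/eisenstein-resource-bdp-line-lead-g11.md` (+ addendum).
-/

set_option autoImplicit false
-- summit-side namespace `Summit.BirchSwinnertonDyer.BirchSwinnertonDyer.…` (single-conjunct summit, D-0017 layout)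
set_option linter.dupNamespace false

noncomputable section

open scoped Classical
open NumberField WeierstrassCurve DirichletCharacter Literature.NumberTheory.LFunctions
  Literature.NumberTheory.EllipticCurves Literature.NumberTheory.EllipticCurves.KrizLi2019
  Literature.NumberTheory.EllipticCurves.Rank1Residual

namespace Summit.BirchSwinnertonDyer.BirchSwinnertonDyer.Theorems.PrintCFram.EisensteinEndStateV19CurveFree

open Summit.BirchSwinnertonDyer.BirchSwinnertonDyer.Theorems.PrintCFram
open Summit.BirchSwinnertonDyer.BirchSwinnertonDyer.Theorems

/-- **END STATE v19 with both residues in elementary currency.** The crux `BottomClassIndexLawFiveLe` follows from: (1) `hprints4` — the FOUR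
print facts of `stub_prints`; (2) `hMW` — Mazur–Wiles 1984 Thm. 2; (3) `hKL` — Kriz–Li 2019 Thm. 1.20; (4) `hP` — w8 g4's CURVE-FREE supply
statement (P) for Heegner fields with a unit field factor (⟹ Stub C by `HeegnerFieldSupply.stubC_of_splitPrimes_bernoulliUnit`); (5) `hLevel` —
B1-level; (6) `hSha` — B1-sha (⟹ B1 by `EisensteinEndStateV19Binders.stubB1_of_stubB1Level_of_stubB1Sha`). Then END STATE v19. CONDITIONAL on
(1)–(6); (4) is OPEN analytic number theory (one rung above Wiles 2015 / Bruinier 1999), (5)–(6) are OPEN arithmetic (BKNO 2026 §1.4); BSD is not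
proved by any of this. [cite: KrizLi2019, Thm. 1.20 (pp. 7–8), §8 (pp. 49–52)] [cite: MazurWiles1984, Thm. 2 (p. 216)]
[cite: BurungaleKobayashiNakamuraOta2026, §1.4 (arXiv:2608.06879 p. 8)] -/
theorem bottomClassIndexLawFiveLe_of_prints4_of_mazurWiles_of_krizLi_of_bernoulliSupply_of_level_of_sha
    (hprints4 :
    Hsieh2014.thmA_exists_isHsiehLFunction_unrPeriod_anyLevel ∧
    LiuZhangZhang2018.thm151_thm153_modularCurve_heegnerVector_additive ∧
    Summit.BirchSwinnertonDyer.BirchSwinnertonDyer.Theses.UniversalToricDescent.ToricPublishedInputs ∧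
    bsdTriple_of_hasCM_of_L_one_ne_zero)
    (hMW : Literature.NumberTheory.NumberFields.MazurWiles1984.thm2_card_oddChiClassGroup_eq_bernoulli)
    (hKL : thm120_padicLogHeegner_unit_of_bernoulli)
    (hP : ∀ (p : ℕ) [Fact p.Prime] (m : ℕ) [NeZero m] (χ : DirichletCharacter ℚ_[p] m) (k : ℕ),
      5 ≤ p → m.Coprime p → χ.IsPrimitive → χ.IsQuadratic → (k = (p + 1) / 4 ∨ k = (3 * p - 1) / 4) →
      2 ≤ k → k ≤ p - 2 → χ (-1) * (-1) ^ k = -1 →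
      ¬ ‖((p - k : ℕ) : ℚ_[p])⁻¹ * generalizedBernoulli (p - k) χ‖ ≤ (p : ℝ)⁻¹ →
      ∃ (K : Type) (_ : Field K) (_ : NumberField K) (εK : DirichletCharacter ℚ_[p] (NumberField.discr K).natAbs),
        IsImaginaryQuadratic K ∧
        (∀ q : ℕ, q.Prime → q ∣ p * m → ((Ideal.span {(q : ℤ)}).primesOver (𝓞 K)).ncard = 2) ∧
        Odd (NumberField.discr K) ∧ NumberField.discr K < -4 ∧ IsKroneckerCharacterOf K εK ∧
        ¬ ‖(k : ℚ_[p])⁻¹ * @generalizedBernoulli ℚ_[p] _ _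
            (changeLevel (dvd_mul_right m (NumberField.discr K).natAbs) χ *
              changeLevel (dvd_mul_left (NumberField.discr K).natAbs m) εK).conductor ⟨conductor_ne_zero _⟩ k
            (changeLevel (dvd_mul_right m (NumberField.discr K).natAbs) χ *
              changeLevel (dvd_mul_left (NumberField.discr K).natAbs m) εK).primitiveCharacter‖ ≤ (p : ℝ)⁻¹)
    (hLevel :
    ∀ (W : WeierstrassCurve ℚ) [W.IsElliptic] [W.IsGloballyMinimal] (p : ℕ) [Fact p.Prime],
      W.HasCM → CMRamified W p → 5 ≤ p → W.analyticRank = 1 →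
      ∀ P : W.toAffine.Point, ¬ IsOfFinAddOrder P →
        (∀ R : W.toAffine.Point, ∃ (k : ℤ) (T : W.toAffine.Point), IsOfFinAddOrder T ∧ R = k • P + T) →
        (∃ Q : (W.baseChange ℚ_[p]).toAffine.Point, p • Q = W.toPadicPoint p P) →
        BSDp W p)
    (hSha :
    ∀ (W : WeierstrassCurve ℚ) [W.IsElliptic] [W.IsGloballyMinimal] (p : ℕ) [Fact p.Prime],
      W.HasCM → CMRamified W p → 5 ≤ p → W.analyticRank = 1 →
      (∃ s ∈ W.sha, s ≠ 0 ∧ p • s = 0) → BSDp W p) :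
    Summit.BirchSwinnertonDyer.BirchSwinnertonDyer.Theses.PrintCFram.BottomClassIndexLawFiveLe :=
  EisensteinEndStateV19Binders.bottomClassIndexLawFiveLe_of_prints4_of_mazurWiles_of_krizLi_of_cover_of_level_of_sha hprints4 hMW hKL
    (HeegnerFieldSupply.stubC_of_splitPrimes_bernoulliUnit hP) hLevel hSha

end Summit.BirchSwinnertonDyer.BirchSwinnertonDyer.Theorems.PrintCFram.EisensteinEndStateV19CurveFree

end
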